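import Summits.Ventures.YMGap.RobustBall.RobustMassGap
import Summits.Ventures.YMGap.RobustBall.PerturbedExistence
import Summits.Ventures.YMGap.StrongCouplingGapShape
import Summits.QuantumFields.BalabanUV.InfraRed.StrongCouplingPoincareDoorSUN
import HarnessLib

/-!
# Venture YMGap, track ROBUST-BALL — the mass gap on the ball (`ℤ^d`, single-link door): statement and proof

HONEST FRAMING. WHAT THIS IS: a venture file (cell `pub-ymgap`, track Y2 ROBUST-BALL, seat rb-p1) that
(1) TYPES the conclusion predicate of the track on `ℤ^d` — `PerturbedMassGapAt d N β W supp`, verbatim the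
cell's `MassGapAt d N β` (unique DLR state + Shen–Zhu–Zhu exponential clustering of Lipschitz cylinder
observables) with the MEMBER's specification `perturbedYM (fundamentalRep (Fin N)) (N β) W supp` in place
of `ymSpecification`, and proves `PerturbedMassGapAt d N β 0 supp ↔ MassGapAt d N β` (referee T1.3);
(2) TYPES the tier-1 `ℤ^d` ball `MemBallZd ε₀ ε₁ R W supp` — continuous adapted link potentials with
locally finite support family `supp`, `ℓ^∞`-range `≤ R`, per-link oscillation load `≤ ε₀` and
cross-Lipschitz load `≤ ε₁` at EVERY link (the loads of rb-theory's design §2.1, stated over `(W, supp)`)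
— and `MassGapOnBallZd d N β ε₀ ε₁ R := ∀ members, PerturbedMassGapAt`; (3) PROVES
`massGapOnBallZd_of_pair`: a one-link Poincaré/variance pair `(c, v)` on the ball `b ≥ 2(d-1)|β|` with
`6(d-1)|β| e^{ε₀} √(c v) + e^{ε₀/2} √c ε₁ < 1` gives `MassGapOnBallZd` (door + existence files), and the
HYPOTHESIS-FREE `SU(2)` instance `su2_massGapOnBallZd`: in Wilson units, for every `d ≥ 1` and every
`(β_W, ε₀, ε₁, R)` with `2(d-1)|β_W| e^{ε₀} + e^{ε₀/2} √(2/3) ε₁ < 1` (d = 4: `6|β_W| e^{ε₀} + …`), from the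
tree's sharp one-link Poincaré constant `2/3` (`oneLinkPoincareSUN_two_sharp`). WHAT THIS IS NOT: the
certified `(β⋆, ε)` ROWS are a separate file (numerals + `norm_num`); no torus/area-law statement; no
star door; strong-coupling LATTICE statement — `ρ < 1` is where the Dobrushin bound closes, not a
transition; no continuum, no Millennium claim.

## References

* Shen–Zhu–Zhu, CMP 400 (2023), Thm. 1.2 / Cor. 1.6 (the clustering currency); Dobrushin 1970;
  Föllmer 1988 Ch. I; Georgii 2011 Thm. 4.17, Ch. 8.
* rb-theory, `HOME/rb/ROBUST-BALL-DESIGN.md` v0.1 §2.1 (loads), §3.2 (ℤ^d object), §8 S5.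
-/

noncomputable section

open MeasureTheory Filter Function ProbabilityTheory Real
open scoped NNReal
open Literature.Probability.LatticeModels
open Literature.Probability.LatticeModels.DobrushinMetric
open Literature.MathematicalPhysics.QuantumLattice
open Literature.MathematicalPhysics.QuantumFieldTheory hiding ZdEdge
open Summit.QuantumFields.BalabanUV.InfraRed.StrongCouplingPoincareDoorSUN (oneLinkPoincareSUN_two_sharp)

namespace Summit.Ventures.YMGap.RobustBall

variable {d N : ℕ}

/-! ### The conclusion predicate of the member -/

variable (d N) in
/-- **The mass gap of the member `N β S_W + W` at 't Hooft coupling `β`** — VERBATIM the cell's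
`MassGapAt d N β` (`StrongCouplingGapShape.lean`) with the member's specification
`perturbedYM (fundamentalRep (Fin N)) (N β) W supp` in place of `ymSpecification … (N β)`:
(i) exactly one DLR state (`HasUniqueGibbsMeasure`), and (ii) for every DLR state a rate `c > 0` and,
per support bound `n`, one constant `c₁` with
`|cov(F₁, F₂)| ≤ c₁ e^{-c d(Λ₁, Λ₂)} (K₁ K₂ + ‖F₁‖₂ ‖F₂‖₂)` for Lipschitz cylinder functions with disjoint
supports of size `≤ n` (Shen–Zhu–Zhu CMP 400 (2023) Cor. 1.6 shape). -/
def PerturbedMassGapAt (β : ℝ) (W : Potential (ZdEdge d) (Matrix.specialUnitaryGroup (Fin N) ℂ))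
    (supp : Finset (ZdEdge d) → Finset (Finset (ZdEdge d))) : Prop :=
  HasUniqueGibbsMeasure (perturbedYM (d := d) (fundamentalRep (Fin N)) (N * β) W supp) ∧
    ∀ μ ∈ perturbedGibbsMeasures (d := d) (fundamentalRep (Fin N)) (N * β) W supp,
      ∃ c : ℝ, 0 < c ∧ ∀ n : ℕ, ∃ c₁ : ℝ,
        ∀ (F₁ F₂ : LGConfig d (Matrix.specialUnitaryGroup (Fin N) ℂ) → ℝ)
          (Λ₁ Λ₂ : Finset (ZdEdge d)) (K₁ K₂ : ℝ≥0),
          Λ₁.card ≤ n → Λ₂.card ≤ n → Disjoint Λ₁ Λ₂ →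
          IsLipschitzCylinder (fundamentalRep (Fin N)) F₁ Λ₁ K₁ →
          IsLipschitzCylinder (fundamentalRep (Fin N)) F₂ Λ₂ K₂ →
            |cov[F₁, F₂; μ]| ≤ c₁ * Real.exp (-c * setDistEdges Λ₁ Λ₂) *
              ((K₁ : ℝ) * K₂ + Real.sqrt (∫ U, F₁ U ^ 2 ∂μ) * Real.sqrt (∫ U, F₂ U ^ 2 ∂μ))

/-- **Consistency with the tree at `W = 0`** (referee T1.3): the member's mass gap at the zero
perturbation is the cell's `MassGapAt d N β`, definitionally up to `perturbedYM_zero`. -/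
theorem perturbedMassGapAt_zero_iff (β : ℝ) (supp : Finset (ZdEdge d) → Finset (Finset (ZdEdge d))) :
    PerturbedMassGapAt d N β 0 supp ↔ MassGapAt d N β := by
  unfold PerturbedMassGapAt MassGapAt perturbedGibbsMeasures ymGibbsMeasures
  rw [perturbedYM_zero]

/-! ### The tier-1 `ℤ^d` ball -/

/-- **Membership of `(W, supp)` in the tier-1 `ℤ^d` ball of radii `(ε₀, ε₁)` and range `R`**: the link
potential `W` has continuous terms depending only on their own links, is locally finitely supported by
`supp`, every listed set through a link `e` lies within `ℓ^∞`-distance `R` of `e`, and there are per-link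
oscillation witnesses `osc` (tree `Dobrushin.IsOscBound`) and Frobenius-Lipschitz witnesses `lip` (tree
`IsLipBound suFrobDist`) with OSCILLATION LOAD `∑_{X ∈ supp{e}, e ∈ X} osc X e ≤ ε₀` and CROSS-LIPSCHITZ
LOAD `∑_{y ∈ perturbedNbr supp e} ∑_{X ∈ supp{e}, e ∈ X} lip X y ≤ ε₁` at EVERY link `e` — the loads of
the design (rb-theory, §2.1), over the `ℤ^d` carrier. No gauge invariance is required on this door. -/
structure MemBallZd (ε₀ ε₁ R : ℝ) (W : Potential (ZdEdge d) (Matrix.specialUnitaryGroup (Fin N) ℂ))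
    (supp : Finset (ZdEdge d) → Finset (Finset (ZdEdge d))) : Prop where
  /-- every term is continuous -/
  continuous : ∀ X, Continuous (W X)
  /-- every term depends only on the links of its set -/
  dependsOn : ∀ X, DependsOn (W X) (↑X : Set (ZdEdge d))
  /-- local finiteness: the active sets meeting a volume are listed -/
  supportedBy : W.IsSupportedBy supp
  /-- range: listed sets through `e` stay within `ℓ^∞`-distance `R` of `e` -/
  range : ∀ e, ∀ X ∈ supp {e}, e ∈ X → ∀ y ∈ X, ‖e.1 - y.1‖ ≤ R
  /-- the per-link loads -/
  loads : ∃ osc lip : Finset (ZdEdge d) → ZdEdge d → ℝ,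
    (∀ X, Dobrushin.IsOscBound (W X) (osc X)) ∧ (∀ X, IsLipBound suFrobDist (W X) (lip X)) ∧
      (∀ e, ∑ X ∈ (supp {e}).filter (fun X => e ∈ X), osc X e ≤ ε₀) ∧
      (∀ e, ∑ y ∈ perturbedNbr supp e, ∑ X ∈ (supp {e}).filter (fun X => e ∈ X), lip X y ≤ ε₁)

/-- The zero potential (with any support family listing only sets within range) is a member of every
ball with nonnegative radii — the centre of the ball is the Wilson action. -/
theorem memBallZd_zero {ε₀ ε₁ R : ℝ} (h₀ : 0 ≤ ε₀) (h₁ : 0 ≤ ε₁)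
    {supp : Finset (ZdEdge d) → Finset (Finset (ZdEdge d))}
    (hR : ∀ e, ∀ X ∈ supp {e}, e ∈ X → ∀ y ∈ X, ‖e.1 - y.1‖ ≤ R) :
    MemBallZd (N := N) ε₀ ε₁ R 0 supp where
  continuous _ := continuous_const
  dependsOn _ _ _ _ := rfl
  supportedBy _ _ _ h := (h rfl).elim
  range := hR
  loads := ⟨fun _ _ => 0, fun _ _ => 0, fun _ => ⟨fun _ => le_rfl, fun _ _ _ _ => by simp⟩,
    fun _ => ⟨fun _ => le_rfl, fun _ _ _ _ => by simp⟩, fun _ => by simpa using h₀, fun _ => by simpa using h₁⟩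

variable (d N) in
/-- **THE TRACK'S `ℤ^d` TARGET TYPE — mass gap uniformly on the ball**: every member `(W, supp)` of the
tier-1 `ℤ^d` ball of radii `(ε₀, ε₁)` and range `R` has the mass gap `PerturbedMassGapAt d N β W supp` at
't Hooft coupling `β`. Nothing is asserted by the definition. -/
def MassGapOnBallZd (β ε₀ ε₁ R : ℝ) : Prop :=
  ∀ (W : Potential (ZdEdge d) (Matrix.specialUnitaryGroup (Fin N) ℂ))
    (supp : Finset (ZdEdge d) → Finset (Finset (ZdEdge d))),
    MemBallZd ε₀ ε₁ R W supp → PerturbedMassGapAt d N β W supp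

/-- The ball theorem contains the Wilson theorem: `MassGapOnBallZd d N β ε₀ ε₁ R → MassGapAt d N β`
(`0 ≤ ε₀, ε₁`, `0 ≤ R`; take the zero member with the empty support family). -/
theorem MassGapOnBallZd.massGapAt {β ε₀ ε₁ R : ℝ} (h : MassGapOnBallZd d N β ε₀ ε₁ R) (h₀ : 0 ≤ ε₀)
    (h₁ : 0 ≤ ε₁) : MassGapAt d N β :=
  (perturbedMassGapAt_zero_iff β fun _ => ∅).1 (h 0 _ (memBallZd_zero h₀ h₁ fun _ _ h => by simp at h))

/-! ### The mass gap on the ball from a one-link pair -/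

/-- **The linear one-link observables inherit the Poincaré constant**: a Lipschitz-variance bound
`Var_{ν_B}(ψ) ≤ c M²` on the ball gives `Var_{ν_B}(N Re tr(g Δ)) ≤ c N² ‖Δ‖_F²`
(`g ↦ N Re tr(g Δ)` is `N‖Δ‖_F`-Lipschitz, tree `abs_re_trace_su_mul_sub_le`). -/
theorem linVariance_of_poincare {b c : ℝ}
    (hP : ∀ B : Matrix (Fin N) (Fin N) ℂ, matrixOpNorm B ≤ b →
      ∀ (ψ : Matrix.specialUnitaryGroup (Fin N) ℂ → ℝ) (M : ℝ), 0 ≤ M →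
        (∀ x y, |ψ x - ψ y| ≤ M * suFrobDist x y) →
        Var[ψ; (haarProbability (Matrix.specialUnitaryGroup (Fin N) ℂ)).tilted
          fun g => (N : ℝ) * ((g : Matrix (Fin N) (Fin N) ℂ) * B).trace.re] ≤ c * M ^ 2) :
    ∀ B : Matrix (Fin N) (Fin N) ℂ, matrixOpNorm B ≤ b → ∀ Δ : Matrix (Fin N) (Fin N) ℂ,
      Var[fun g : Matrix.specialUnitaryGroup (Fin N) ℂ =>
          (N : ℝ) * ((g : Matrix (Fin N) (Fin N) ℂ) * Δ).trace.re;
        (haarProbability (Matrix.specialUnitaryGroup (Fin N) ℂ)).tilted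
          fun g => (N : ℝ) * ((g : Matrix (Fin N) (Fin N) ℂ) * B).trace.re] ≤
        c * (N : ℝ) ^ 2 * frobNorm Δ ^ 2 := by
  intro B hB Δ
  have hN0 : (0 : ℝ) ≤ N := Nat.cast_nonneg N
  have h := hP B hB (fun g => (N : ℝ) * ((g : Matrix (Fin N) (Fin N) ℂ) * Δ).trace.re)
    ((N : ℝ) * frobNorm Δ) (mul_nonneg hN0 (frobNorm_nonneg _)) fun x y => by
      rw [← mul_sub, abs_mul, abs_of_nonneg hN0, mul_assoc]
      refine mul_le_mul_of_nonneg_left ?_ hN0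
      rw [mul_comm]
      exact abs_re_trace_su_mul_sub_le x y Δ
  calc _ ≤ c * ((N : ℝ) * frobNorm Δ) ^ 2 := h
    _ = c * (N : ℝ) ^ 2 * frobNorm Δ ^ 2 := by ring

/-- **Mass gap of a member from a one-link pair** (door + existence): for `d ≥ 1`, `N ≥ 1`, a 't Hooft
coupling `β`, a one-link Poincaré/variance pair `(c, v)` on the ball `b ≥ 2(d-1)|β|`, and a member
`(W, supp)` of `MemBallZd ε₀ ε₁ R` with
`6(d-1)|β| e^{ε₀} √(c v) + e^{ε₀/2} √c ε₁ < 1`, the member has the mass gap `PerturbedMassGapAt d N β W supp`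
(uniqueness `subsingleton_perturbedGibbsMeasures_SU` + existence `perturbedGibbsMeasures_nonempty`;
clustering `perturbed_covariance_decay_SU` with rate `-log max(ρ, 1/2)/max(1, R)`). -/
theorem perturbedMassGapAt_of_pair (hd : 1 ≤ d) (hN : 1 ≤ N) {β b c v ε₀ ε₁ R : ℝ} (hc : 0 ≤ c)
    (hv : 0 ≤ v) (hb : |β| * (2 * ((d : ℝ) - 1)) ≤ b)
    (hP : ∀ B : Matrix (Fin N) (Fin N) ℂ, matrixOpNorm B ≤ b →
      ∀ (ψ : Matrix.specialUnitaryGroup (Fin N) ℂ → ℝ) (M : ℝ), 0 ≤ M →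
        (∀ x y, |ψ x - ψ y| ≤ M * suFrobDist x y) →
        Var[ψ; (haarProbability (Matrix.specialUnitaryGroup (Fin N) ℂ)).tilted
          fun g => (N : ℝ) * ((g : Matrix (Fin N) (Fin N) ℂ) * B).trace.re] ≤ c * M ^ 2)
    (hVB : ∀ B : Matrix (Fin N) (Fin N) ℂ, matrixOpNorm B ≤ b → ∀ Δ : Matrix (Fin N) (Fin N) ℂ,
      Var[fun g : Matrix.specialUnitaryGroup (Fin N) ℂ =>
          (N : ℝ) * ((g : Matrix (Fin N) (Fin N) ℂ) * Δ).trace.re;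
        (haarProbability (Matrix.specialUnitaryGroup (Fin N) ℂ)).tilted
          fun g => (N : ℝ) * ((g : Matrix (Fin N) (Fin N) ℂ) * B).trace.re] ≤ v * frobNorm Δ ^ 2)
    {W : Potential (ZdEdge d) (Matrix.specialUnitaryGroup (Fin N) ℂ)}
    {supp : Finset (ZdEdge d) → Finset (Finset (ZdEdge d))} (hmem : MemBallZd ε₀ ε₁ R W supp)
    (hρ : 6 * ((d : ℝ) - 1) * |β| * (exp ε₀ * Real.sqrt (c * v)) + exp (ε₀ / 2) * Real.sqrt c * ε₁ < 1) :
    PerturbedMassGapAt d N β W supp := by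
  haveI : SecondCountableTopology (Matrix (Fin N) (Fin N) ℂ) :=
    inferInstanceAs (SecondCountableTopology (Fin N → Fin N → ℂ))
  haveI : SecondCountableTopology (Matrix.specialUnitaryGroup (Fin N) ℂ) :=
    Topology.IsEmbedding.subtypeVal.secondCountableTopology
  obtain ⟨osc, lip, hosc, hlip, hosca, hΛ⟩ := hmem.loads
  have hW : W.IsAdapted := fun X => ⟨hmem.dependsOn X, (hmem.continuous X).measurable⟩
  have hWb : ∀ X, ∃ C, ∀ U, |W X U| ≤ C := fun X => exists_bound_of_continuous (hmem.continuous X)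
  set ρ : ℝ := 6 * ((d : ℝ) - 1) * |β| * (exp ε₀ * Real.sqrt (c * v)) + exp (ε₀ / 2) * Real.sqrt c * ε₁
    with hρdef
  refine ⟨⟨subsingleton_perturbedGibbsMeasures_SU hd hN hc hv hb hP hVB hW hWb hmem.supportedBy hosc hosca
      hlip hΛ hρ, perturbedGibbsMeasures_nonempty _ (continuous_fundamentalRep (Fin N)) _ hmem.continuous
      hmem.dependsOn hmem.supportedBy⟩, fun μ hμ => ?_⟩
  have hc'0 : 0 < max ρ (1 / 2) := lt_max_of_lt_right (by norm_num)
  have hc'1 : max ρ (1 / 2) < 1 := max_lt hρ (by norm_num)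
  have hκ0 : 0 < -Real.log (max ρ (1 / 2)) := neg_pos.2 (Real.log_neg hc'0 hc'1)
  have hR₀ : 0 < max 1 R := zero_lt_one.trans_le (le_max_left _ _)
  refine ⟨-Real.log (max ρ (1 / 2)) / max 1 R, div_pos hκ0 hR₀, fun n =>
    ⟨2 * (2 * Real.sqrt N) ^ 2 * (n : ℝ) ^ 2 * exp (-Real.log (max ρ (1 / 2))), ?_⟩⟩
  intro F₁ F₂ Λ₁ Λ₂ K₁ K₂ h₁ h₂ hdisj hF₁ hF₂
  exact perturbed_covariance_decay_SU hd hN hc hv hb hP hVB hW hWb hmem.supportedBy hosc hosca hlip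
    hΛ hmem.range hρ μ hμ n F₁ F₂ Λ₁ Λ₂ K₁ K₂ h₁ h₂ hdisj hF₁ hF₂

variable (d N) in
/-- **MASS GAP ON THE BALL from a one-link pair** — the tier-1 `ℤ^d` ball theorem with the one-link
input left symbolic: `(c, v)` a Poincaré/variance pair of the UNPERTURBED `SU(N)` one-link family on
`‖B‖_op ≤ b`, `b ≥ 2(d-1)|β|`, and `6(d-1)|β| e^{ε₀} √(c v) + e^{ε₀/2} √c ε₁ < 1` give
`MassGapOnBallZd d N β ε₀ ε₁ R` for every range `R`. All-`N` rows: `(c, v)` = Bakry–Émery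
`(1/(N(1/2-b)), N/(1/2-b))` (tree `oneLinkPoincareSUN_bakryEmery`, `oneLinkVarianceBound_bakryEmery`). -/
theorem massGapOnBallZd_of_pair (hd : 1 ≤ d) (hN : 1 ≤ N) {β b c v ε₀ ε₁ : ℝ} (R : ℝ) (hc : 0 ≤ c)
    (hv : 0 ≤ v) (hb : |β| * (2 * ((d : ℝ) - 1)) ≤ b)
    (hP : ∀ B : Matrix (Fin N) (Fin N) ℂ, matrixOpNorm B ≤ b →
      ∀ (ψ : Matrix.specialUnitaryGroup (Fin N) ℂ → ℝ) (M : ℝ), 0 ≤ M →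
        (∀ x y, |ψ x - ψ y| ≤ M * suFrobDist x y) →
        Var[ψ; (haarProbability (Matrix.specialUnitaryGroup (Fin N) ℂ)).tilted
          fun g => (N : ℝ) * ((g : Matrix (Fin N) (Fin N) ℂ) * B).trace.re] ≤ c * M ^ 2)
    (hVB : ∀ B : Matrix (Fin N) (Fin N) ℂ, matrixOpNorm B ≤ b → ∀ Δ : Matrix (Fin N) (Fin N) ℂ,
      Var[fun g : Matrix.specialUnitaryGroup (Fin N) ℂ =>
          (N : ℝ) * ((g : Matrix (Fin N) (Fin N) ℂ) * Δ).trace.re;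
        (haarProbability (Matrix.specialUnitaryGroup (Fin N) ℂ)).tilted
          fun g => (N : ℝ) * ((g : Matrix (Fin N) (Fin N) ℂ) * B).trace.re] ≤ v * frobNorm Δ ^ 2)
    (hρ : 6 * ((d : ℝ) - 1) * |β| * (exp ε₀ * Real.sqrt (c * v)) + exp (ε₀ / 2) * Real.sqrt c * ε₁ < 1) :
    MassGapOnBallZd d N β ε₀ ε₁ R :=
  fun _ _ hmem => perturbedMassGapAt_of_pair hd hN hc hv hb hP hVB hmem hρ

/-! ### `SU(2)`: the hypothesis-free ball theorem in Wilson units -/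

/-- **MASS GAP ON THE BALL FOR `SU(2)`, HYPOTHESIS-FREE, every dimension `d ≥ 1`** (Wilson units:
't Hooft `β = β_W/4`, tree coupling `β_W/2`): for every `β_W, ε₀, ε₁, R` with
`2(d-1)|β_W| e^{ε₀} + e^{ε₀/2} √(2/3) ε₁ < 1` (for `d = 4`: `6|β_W| e^{ε₀} + 0.8165… e^{ε₀/2} ε₁ < 1`),
`MassGapOnBallZd d 2 (β_W/4) ε₀ ε₁ R`: every member of the tier-1 `ℤ^d` ball — continuous adapted link
potential of range `R`, oscillation load `≤ ε₀` and cross-Lipschitz load `≤ ε₁` at every link — added to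
the `SU(2)` Wilson action at `β_W` has exactly one DLR state, exponentially clustering. One-link input:
the tree's SHARP Poincaré constant `2/3` for every tilt (`oneLinkPoincareSUN_two_sharp`) and the induced
linear variance `v = 8/3` (`√(c v) = 4/3`). At `ε₀ = ε₁ = 0` this is the Poincaré-route Wilson window
`β_W < 1/(2(d-1))` (`d = 4`: `1/6`). -/
theorem su2_massGapOnBallZd (hd : 1 ≤ d) {βW ε₀ ε₁ : ℝ} (R : ℝ)
    (hρ : 2 * ((d : ℝ) - 1) * |βW| * exp ε₀ + exp (ε₀ / 2) * Real.sqrt (2 / 3) * ε₁ < 1) :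
    MassGapOnBallZd d 2 (βW / 4) ε₀ ε₁ R := by
  have hc : (0 : ℝ) ≤ 2 / 3 := by norm_num
  have hP : ∀ B : Matrix (Fin 2) (Fin 2) ℂ, matrixOpNorm B ≤ |βW / 4| * (2 * ((d : ℝ) - 1)) →
      ∀ (ψ : Matrix.specialUnitaryGroup (Fin 2) ℂ → ℝ) (M : ℝ), 0 ≤ M →
        (∀ x y, |ψ x - ψ y| ≤ M * suFrobDist x y) →
        Var[ψ; (haarProbability (Matrix.specialUnitaryGroup (Fin 2) ℂ)).tilted
          fun g => ((2 : ℕ) : ℝ) * ((g : Matrix (Fin 2) (Fin 2) ℂ) * B).trace.re] ≤ 2 / 3 * M ^ 2 :=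
    fun B hB ψ M hM hψ => oneLinkPoincareSUN_two_sharp _ B hB ψ M hM hψ
  have hVB := linVariance_of_poincare (N := 2) hP
  have hv : (0 : ℝ) ≤ 2 / 3 * ((2 : ℕ) : ℝ) ^ 2 := by norm_num
  refine massGapOnBallZd_of_pair d 2 hd (by norm_num) R hc hv le_rfl hP hVB ?_
  have hsq : Real.sqrt (2 / 3 * (2 / 3 * ((2 : ℕ) : ℝ) ^ 2)) = 4 / 3 := by
    rw [show (2 / 3 * (2 / 3 * ((2 : ℕ) : ℝ) ^ 2) : ℝ) = (4 / 3) ^ 2 by norm_num,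
      Real.sqrt_sq (by norm_num)]
  rw [hsq]
  have e : 6 * ((d : ℝ) - 1) * |βW / 4| * (exp ε₀ * (4 / 3)) = 2 * ((d : ℝ) - 1) * |βW| * exp ε₀ := by
    rw [abs_div, abs_of_pos (by norm_num : (0 : ℝ) < 4)]
    ring
  rw [e]
  exact hρ

/-- The `d = 4` reading: `6|β_W| e^{ε₀} + e^{ε₀/2} √(2/3) ε₁ < 1 ⇒ MassGapOnBallZd 4 2 (β_W/4) ε₀ ε₁ R`. -/
theorem su2_massGapOnBallZd_dim4 {βW ε₀ ε₁ : ℝ} (R : ℝ)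
    (hρ : 6 * |βW| * exp ε₀ + exp (ε₀ / 2) * Real.sqrt (2 / 3) * ε₁ < 1) :
    MassGapOnBallZd 4 2 (βW / 4) ε₀ ε₁ R :=
  su2_massGapOnBallZd (by norm_num) R (by
    have h6 : (2 : ℝ) * (((4 : ℕ) : ℝ) - 1) = 6 := by norm_num
    calc 2 * (((4 : ℕ) : ℝ) - 1) * |βW| * exp ε₀ + exp (ε₀ / 2) * Real.sqrt (2 / 3) * ε₁
        = 6 * |βW| * exp ε₀ + exp (ε₀ / 2) * Real.sqrt (2 / 3) * ε₁ := by rw [h6]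
      _ < 1 := hρ)

end Summit.Ventures.YMGap.RobustBall
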